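import Summits.HodgeConjecture.HodgeConjecture.Theorems.NikulinTwinTransportLefschetzOneOneK3ChernCharacter

/-!
# Route NikulinTwinTransport — `LefschetzOneOneK3`: the Euler-characteristic form of the residual input

Helper file (`--supports stmt-HodgeConjecture-13678`) for the route item `LefschetzOneOneK3`
(Lefschetz `(1,1)` for the projective K3 surfaces of the route). State of the item in the tree: the
analytic Lefschetz `(1,1)` theorem, Čech integrality, Chow, the meromorphic section `σ₁/σ₂`, the
algebraicity of `c₁(𝒪_X(D)^an)` and the holomorphic section `s^an` of a non-zero algebraic section `s`
are PROVED, so that the item follows from the Kodaira–Serre existence of ONE non-zero holomorphic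
section of `L ⊗ 𝒪_X(D)^an` for every holomorphic line cocycle `L` on a Hodge model of a surface of the
item (`lefschetzOneOneK3_of_exists_section_algebraicTwist`), equivalently from GAGA for line bundles
(`lefschetzOneOneK3_of_serreGAGA`, named fact `serreGAGA_lineCocycle_iso_cartierDivisorCocycle`).

This file records that the residual input needs NEITHER GAGA (Serre's Théorème 3) NOR Kodaira
vanishing NOR Serre duality, but only finiteness and two long exact sequences, through the following
EULER-CHARACTERISTIC ARGUMENT on a smooth projective surface `X ⊂ ℙ^N` with Hodge model `M`,
holomorphic line cocycle `L`, `𝓗 = 𝒪_X(1)^an`, a smooth hyperplane section `C = {t = 0}` (Bertini) and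
a second form `t'` meeting `C` transversally in `δ ≥ 1` points. Writing `h^q(n) = dim H^q(M; L𝓗ⁿ)`,
`q^q(m) = dim Ȟ^q(Q_m)` for the cokernel presheaf `Q_m = 𝒪(L𝓗ᵐ)/t·𝒪(L𝓗ᵐ⁻¹)` ("`L𝓗ᵐ|_C`") and
`r^q` for the cokernel of `t'` on `Q` (the skyscraper at `C ∩ C'`: `r⁰ = δ`, `r¹ = 0`), the initial
six terms of the two long exact sequences give (`finrank_six_term_le`, rank–nullity four times)

  `h⁰(n) + q⁰(n+1) + h¹(n+1) ≤ h⁰(n+1) + h¹(n) + q¹(n+1)`,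
  `q⁰(m) + δ + q¹(m+1) ≤ q⁰(m+1) + q¹(m) + r¹`,

whence (`exists_lt_of_euler_inequalities`: `χ_Q` grows linearly, `χ = h⁰ − h¹` quadratically, and
`h⁰ ≥ χ`) `h⁰(n) → ∞`; in particular `L ⊗ 𝒪_X(n)^an` has a non-zero section for some `n`. So the
item follows from a NUMERICAL package (`lefschetzOneOneK3_of_eulerInequalities`), whose analytic
content is: Cartan–Serre finiteness for `H^{0,q}_∂̄(M; L)` (`q = 1, 2`; the tree proves the untwisted
case, `Literature.NumberTheory.Transcendental.finite_dolbeaultCohomology_holds`), the injections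
`Ȟ^q(𝔘; 𝒪(L)) ↪ H^{0,q}_∂̄(M; L)` for covers by `∂̄`-acyclic sets, the long exact sequences of Čech
cohomology for the two short exact sequences of presheaves (pure homological algebra once `t` is a
non-zero-divisor and `(t, t')` is regular on the members of an adapted cover), Bertini
(`Literature/AlgebraicGeometry/Resolution/LinearSectionsBertini`) and the Čech computation of the
skyscraper. The target of that programme — Serre's Théorème A for the coherent analytic sheaf of
sections of a holomorphic line cocycle on a smooth projective SURFACE, in the sections form consumed by
`lefschetzOneOneK3_of_exists_section_algebraicTwist` — is stated as a named fact in the companion file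
`NikulinTwinTransportLefschetzOneOneK3SerreTheoremA`; it is implied by
`serreGAGA_lineCocycle_iso_cartierDivisorCocycle` together with the algebraic theorem A, and it is
what the Euler-characteristic argument proves.
-/

noncomputable section

-- `Summit.HodgeConjecture.HodgeConjecture.Theorems` is the mandated namespace (single-problem summit:
-- Problem = Summit), which `linter.dupNamespace` flags; the lakefile turns the linter off tree-wide
-- (weak option), restated here so stand-alone elaboration is warning-free too.
set_option linter.dupNamespace false

namespace Summit.HodgeConjecture.HodgeConjecture.Theorems

open scoped Manifold ContDiff
open Set AlgebraicGeometry Module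
open Literature.Geometry.Kaehler
open Literature.AlgebraicGeometry
open Literature.AlgebraicGeometry.Motives
open Literature.AlgebraicGeometry.HodgeTheory
open Summit.HodgeConjecture.HodgeConjecture.Theses.NikulinTwinTransport

/-! ### Rank–nullity along six terms of a long exact sequence -/

section SixTerm

variable {K : Type*} [Field K]
  {V₀ V₁ V₂ V₃ V₄ V₅ : Type*}
  [AddCommGroup V₀] [Module K V₀]
  [AddCommGroup V₁] [Module K V₁] [FiniteDimensional K V₁]
  [AddCommGroup V₂] [Module K V₂] [FiniteDimensional K V₂]
  [AddCommGroup V₃] [Module K V₃] [FiniteDimensional K V₃]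
  [AddCommGroup V₄] [Module K V₄] [FiniteDimensional K V₄]
  [AddCommGroup V₅] [Module K V₅] [FiniteDimensional K V₅]

/-- **Rank–nullity along the first six terms of a long exact sequence.** For linear maps
`V₀ →a V₁ →b V₂ →c V₃ →d V₄ →e V₅` of finite-dimensional spaces with `a` injective and exactness at
`V₁, V₂, V₃, V₄`, one has `dim V₀ + dim V₂ + dim V₄ ≤ dim V₁ + dim V₃ + dim V₅` (equality iff `e` is
onto). With `V• = (H⁰(L(n)), H⁰(L(n+1)), H⁰(C, L(n+1)), H¹(L(n)), H¹(L(n+1)), H¹(C, L(n+1)))` this is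
the inequality `χ(L(n+1)) ≥ χ(L(n)) + χ_C(L(n+1))` of truncated Euler characteristics `χ = h⁰ − h¹`
used in the dimension count of Serre's Théorème A. [folklore] -/
theorem finrank_six_term_le (a : V₀ →ₗ[K] V₁) (b : V₁ →ₗ[K] V₂) (c : V₂ →ₗ[K] V₃)
    (d : V₃ →ₗ[K] V₄) (e : V₄ →ₗ[K] V₅) (ha : Function.Injective a) (hab : Function.Exact a b)
    (hbc : Function.Exact b c) (hcd : Function.Exact c d) (hde : Function.Exact d e) :
    finrank K V₀ + finrank K V₂ + finrank K V₄ ≤ finrank K V₁ + finrank K V₃ + finrank K V₅ := by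
  have h₁ := b.finrank_range_add_finrank_ker
  have h₂ := c.finrank_range_add_finrank_ker
  have h₃ := d.finrank_range_add_finrank_ker
  have h₄ := e.finrank_range_add_finrank_ker
  rw [LinearMap.exact_iff] at hab hbc hcd hde
  rw [hab, LinearMap.finrank_range_of_inj ha] at h₁
  rw [hbc] at h₂
  rw [hcd] at h₃
  rw [hde] at h₄
  have h₅ : finrank K (LinearMap.range e) ≤ finrank K V₅ := Submodule.finrank_le _
  omega

end SixTerm

/-! ### The growth of `h⁰` from the two inequalities -/

/-- **Quadratic growth of `h⁰` from the two six-term inequalities.** If `h⁰, h¹` (on the surface)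
and `q⁰, q¹` (on the curve) satisfy, for all `n`, `m`,
`h⁰(n) + q⁰(n+1) + h¹(n+1) ≤ h⁰(n+1) + h¹(n) + q¹(n+1)` and
`q⁰(m) + δ + q¹(m+1) ≤ q⁰(m+1) + q¹(m) + r` with `r < δ`, then `h⁰` is unbounded: `χ_Q = q⁰ − q¹`
grows at least linearly, `χ = h⁰ − h¹` at least quadratically, and `h⁰ ≥ χ`. This is the dimension
count `h⁰(L(n)) ≥ Σ_{m ≤ n} χ_C(L(m)) − h¹(L)` behind Serre's Théorème A for a line bundle on a
surface, with Serre duality and vanishing theorems replaced by monotone bookkeeping. [folklore] -/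
theorem exists_lt_of_euler_inequalities (h0 h1 q0 q1 : ℕ → ℕ) (δ r : ℕ) (hr : r < δ)
    (hS : ∀ n, h0 n + q0 (n + 1) + h1 (n + 1) ≤ h0 (n + 1) + h1 n + q1 (n + 1))
    (hC : ∀ m, q0 m + δ + q1 (m + 1) ≤ q0 (m + 1) + q1 m + r) (B : ℕ) :
    ∃ n, B < h0 n := by
  -- the truncated Euler characteristics, in `ℤ`
  set χS : ℕ → ℤ := fun n ↦ (h0 n : ℤ) - h1 n with hχS
  set χQ : ℕ → ℤ := fun m ↦ (q0 m : ℤ) - q1 m with hχQ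
  have hQstep : ∀ m, χQ m + 1 ≤ χQ (m + 1) := fun m ↦ by
    have := hC m
    simp only [hχQ]
    omega
  have hQlin : ∀ m, χQ 0 + m ≤ χQ m := fun m ↦ by
    induction m with
    | zero => simp
    | succ k ih => have := hQstep k; push_cast; omega
  have hSstep : ∀ n, χS n + χQ (n + 1) ≤ χS (n + 1) := fun n ↦ by
    have := hS n
    simp only [hχS, hχQ]
    omega
  -- `2 χS(n) ≥ 2 χS(0) + 2 n χQ(0) + n (n + 1)`
  have hSquad : ∀ n : ℕ, 2 * χS 0 + 2 * n * χQ 0 + n * (n + 1) ≤ 2 * χS n := fun n ↦ by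
    induction n with
    | zero => simp
    | succ k ih =>
      have h₁ := hSstep k
      have h₂ := hQlin (k + 1)
      push_cast at h₂ ⊢
      nlinarith
  -- lower bounds for the initial values
  have hS0 : -(h1 0 : ℤ) ≤ χS 0 := by simp only [hχS]; omega
  have hQ0 : -(q1 0 : ℤ) ≤ χQ 0 := by simp only [hχQ]; omega
  -- an explicit large index
  set T : ℕ := B + h1 0 + q1 0 + 1 with hT
  refine ⟨2 * T + 1, ?_⟩
  have hmain := hSquad (2 * T + 1)
  have hle : χS (2 * T + 1) ≤ h0 (2 * T + 1) := by simp only [hχS]; omega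
  -- `2 χS(0) + 2 (2T+1) χQ(0) + (2T+1)(2T+2) > 2B`
  have hkey : 2 * (B : ℤ) < 2 * χS 0 + 2 * ((2 * T + 1 : ℕ) : ℤ) * χQ 0 +
      ((2 * T + 1 : ℕ) : ℤ) * ((2 * T + 1 : ℕ) + 1) := by
    push_cast
    nlinarith
  have : 2 * (B : ℤ) < 2 * (h0 (2 * T + 1) : ℤ) := by linarith
  exact_mod_cast (by linarith : (B : ℤ) < h0 (2 * T + 1))

/-! ### The item from the numerical package -/

/-- **`LefschetzOneOneK3` from the Euler-characteristic package.** Suppose that for every holomorphic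
line cocycle `L` on a Hodge model `A` of a surface `S` of the item there are holomorphic line cocycles
`H n` (`n ∈ ℕ`; e.g. `H n = 𝒪_S(n)^an`, the `cartierDivisorLineBundle` of `n` hyperplane sections) with
non-zero global sections `τ n` (e.g. the analytified algebraic section `1`,
`exists_globalSection_cartierDivisorLineBundle_zeroSet_ne_univ`), and natural numbers
`h⁰(n), h¹(n), q⁰(m), q¹(m), δ > r` satisfying the two six-term inequalities of
`exists_lt_of_euler_inequalities` (`finrank_six_term_le` applied to the long exact sequences of
`0 → L ⊗ H(n) → L ⊗ H(n+1) → (L ⊗ H(n+1))|_C → 0` and of the restriction from `C` to `C ∩ C'`), such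
that `h⁰(n) > 0` yields a non-zero holomorphic section of `L ⊗ H n`
(`h⁰(n) = dim H⁰(S^an, L ⊗ H n)`). Then `LefschetzOneOneK3` holds: `h⁰` is unbounded
(`exists_lt_of_euler_inequalities`), and `lefschetzOneOneK3_of_globalSections` (the meromorphic section
`σ/τ`, Čech integrality, Chow, the analytic Lefschetz `(1,1)` theorem — all proved) applies.
[cite: SerreGAGA1956, n° 16–17] [cite: VoisinHodgeI2002, Cor. 11.34 (proof)] -/
theorem lefschetzOneOneK3_of_eulerInequalities
    (h : ∀ ⦃S : Motives.SchemeOver ℂ⦄,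
      (Motives.IsSmoothProjective 2 S ∧ Subsingleton (Motives.structureSheafCohomology S.left 1) ∧
        ∃ (A : HodgeModel 2 S) (η : MForm 𝓘(ℝ, A.model) A.carrier ℂ 2),
          Literature.Geometry.Kaehler.IsHolomorphicInCharts η ∧ ∀ x, η x ≠ 0) →
      ∀ (A : HodgeModel 2 S) (ι : Type) (L : HolomorphicLineBundle ι A.model A.carrier),
        ∃ (κ : ℕ → Type) (H : ∀ n, HolomorphicLineBundle (κ n) A.model A.carrier)
          (h0 h1 q0 q1 : ℕ → ℕ) (δ r : ℕ), r < δ ∧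
          (∀ n, h0 n + q0 (n + 1) + h1 (n + 1) ≤ h0 (n + 1) + h1 n + q1 (n + 1)) ∧
          (∀ m, q0 m + δ + q1 (m + 1) ≤ q0 (m + 1) + q1 m + r) ∧
          (∀ n, ∃ τ : (H n).GlobalSection, τ.zeroSet ≠ univ) ∧
          (∀ n, 0 < h0 n → ∃ σ : (L.tensor (H n)).GlobalSection, σ.zeroSet ≠ univ)) :
    LefschetzOneOneK3 := by
  refine lefschetzOneOneK3_of_globalSections fun S hS A ι L ↦ ?_
  obtain ⟨κ, H, h0, h1, q0, q1, δ, r, hr, hSineq, hCineq, hτ, hσ⟩ := h hS A ι L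
  obtain ⟨n, hn⟩ := exists_lt_of_euler_inequalities h0 h1 q0 q1 δ r hr hSineq hCineq 0
  obtain ⟨τ, hτ'⟩ := hτ n
  obtain ⟨σ, hσ'⟩ := hσ n hn
  exact ⟨κ n, H n, σ, τ, hσ', hτ'⟩

end Summit.HodgeConjecture.HodgeConjecture.Theorems

end
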